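import Summits.HodgeConjecture.HodgeConjecture.Theorems.MarkmanPartnerTransportPicardThreeK3SquaresCellGen
import Summits.HodgeConjecture.HodgeConjecture.Theorems.MarkmanPartnerTransportPicardThreeK3SquaresOneCycleConsequences
import Literature.AlgebraicGeometry.Surfaces.K3RealMultiplicationExistence

/-!
# Route MarkmanPartnerTransport · crux `PicardThreeK3Squares` (stmt-HodgeConjecture-19652) —
# «K3-CELL-GEN SOCKET»: HC⁴(S × S), `IsCycleInducedRMK3` and HC⁴(S^{[2]}) from ONE algebraic class in a KNOWN RM type

Sequel to `…PicardThreeK3SquaresCellGen` («K3-CELL-GEN»: in a known real-multiplication type an admissible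
endomorphism whose `(2,0)`-eigenvalue has full degree — any irrational eigenvalue when the degree is prime —
generates `End_Hdg(T(S))`). Prover seat hodge-nonav-20241-p1 (gen 16); `--supports stmt-HodgeConjecture-19652` helper.
Consumers, all by the `N¹`-stable rung F4 `hodgeConjectureFor_square_of_generatedBy_of_mapsTo` (FACT-FREE):

* `hodgeConjectureFor_square_of_generatedBy_of_cycleInduced_natDegree` (+ `…_irrational_of_prime`) — a projective
  K3 surface `S` (granted markings) with a GENERATING rational Hodge endomorphism `θ` of `(2,0)`-eigenvalue degree
  `d` and ONE cycle-induced transcendental endomorphism `t` (`IsCycleInducedTranscendentalEndomorphism`: rational,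
  type-preserving, kills `N¹`, image `⊥ N¹`, `t = [γ]_*`, `γ ∈ A²(S × S)`) of `(2,0)`-eigenvalue degree `d`
  (resp. irrational, `d` prime) has `HodgeConjectureFor 4 (S ⊗ S)` — modulo `Huybrechts_K3_marking_exists` ONLY
  (no Buskin: a known RM type has no CM branch; no degree law);
* `exists_generator_natDegree_of_isRealMultiplicationK3` — van Geemen–Schütt's vocabulary: `IsRealMultiplicationK3 S ρ P`
  with `P` irreducible supplies such a `θ` with `d = deg P`;
* `hodgeConjectureFor_square_of_isRealMultiplicationK3_of_cycleInduced_natDegree` (+ `…_irrational_of_prime`) —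
  **an RM K3 surface of type `ℚ[X]/(P)` carrying ONE algebraic self-correspondence whose `(2,0)`-eigenvalue has
  degree `deg P` (resp. is irrational, `deg P` prime) satisfies HC⁴(S × S)**, mod markings only;
* `isCycleInducedRMK3_of_isRealMultiplicationK3_of_cycleInduced_natDegree` — and is a CYCLE-INDUCED RM K3 surface
  in the sense of `IsCycleInducedRMK3` (for the minimal polynomial of the eigenvalue of `t`);
* `hodgeConjectureFor_hilbertSquare_of_isRealMultiplicationK3_of_cycleInduced_irrational_of_prime` — the Hilbert
  square `S^{[2]}` (mod Beauville's blow-up description), e.g. the K3 side of cell `(3,5)` of crux #5: an RM K3 of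
  type `ℚ(ζ₁₁ + ζ₁₁⁻¹)` (`ρ(S) = 2`) with one cycle of irrational eigenvalue.

CONDITIONAL on the displayed named facts; nothing here constructs a cycle; credits nothing to HC; no definition,
no sorry, no new named fact.

References: B. van Geemen, M. Schütt, Forum Math. Sigma 13 (2025) e2, §2.1, §4.8, Rem. 4.9, Thm. 1.1 (11);
Yu. G. Zarhin, J. reine angew. Math. 341 (1983) Thm. 1.5.1; M. Varesco, Math. Z. 305 (2023) §2; A. Beauville,
J. Differential Geom. 18 (1983) §6.
-/

set_option linter.dupNamespace false

noncomputable section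

namespace Summit.HodgeConjecture.HodgeConjecture.Theorems.MarkmanPartnerTransport.OneCycle

open Module CategoryTheory MonoidalCategory Polynomial
open Literature.AlgebraicGeometry Literature.AlgebraicGeometry.Motives Literature.AlgebraicGeometry.HodgeTheory
open Literature.AlgebraicGeometry.Surfaces Literature.AlgebraicGeometry.HilbertScheme
open Literature.AlgebraicTopology.SingularHomology
open Summit.HodgeConjecture.HodgeConjecture.Theorems

variable {S H : SchemeOver ℂ}

/-- `Transc[S, y]`: `y` is cup-orthogonal to `N¹(S)`. Local notation only. -/
local notation3 (prettyPrint := false) "Transc[" S ", " y "]" =>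
  (∀ d ∈ algebraicClasses S 1, cupProduct (rfl : 2 * 1 + 2 * 1 = 2 * 2) y d = 0)

/-! ### §1 HC⁴(S × S) from a generating `θ` and one cycle of full eigenvalue degree — markings only -/

/-- **ONE CYCLE SUFFICES IN A KNOWN RM TYPE (degree form).** For a projective K3 surface `S` (granted markings), a
rational, type-preserving `θ` generating `End_Hdg(T(S))` with `(2,0)`-eigenvalue of degree `d`, and ONE cycle-induced
transcendental endomorphism `t` whose `(2,0)`-eigenvalue has degree `d`: `HodgeConjectureFor 4 (S ⊗ S)` —
`End_Hdg(T(S)) = ℚ[t|_T]` by «K3-CELL-GEN», then the `N¹`-stable rung F4. Modulo `Huybrechts_K3_marking_exists`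
only. [cite: GeemenSchutt2023, §4.8 and Rem. 4.9] [cite: Varesco2023, §2 (p. 8)] [cite: Zarhin1983HodgeGroupsK3, Thm. 1.5.1] -/
theorem hodgeConjectureFor_square_of_generatedBy_of_cycleInduced_natDegree (hmark : Huybrechts_K3_marking_exists)
    (hS : IsK3Surface S) (θ : complexBetti S (2 * 1) →ₗ[ℂ] complexBetti S (2 * 1))
    (hθ_rat : ∀ y, IsRationalClass y → IsRationalClass (θ y))
    (hθ_typ : ∀ (i j : ℕ) y, IsOfHodgeType 2 S (2 * 1) i j y → IsOfHodgeType 2 S (2 * 1) i j (θ y))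
    (hθ_gen : TranscendentalEndomorphismsGeneratedBy S θ) {d : ℕ}
    (hθ_ev : ∃ (σ₀ : complexBetti S (2 * 1)) (ev₀ : ℂ), IsOfHodgeType 2 S (2 * 1) 2 0 σ₀ ∧ σ₀ ≠ 0 ∧
      θ σ₀ = ev₀ • σ₀ ∧ (minpoly ℚ ev₀).natDegree = d)
    (t : complexBetti S (2 * 1) →ₗ[ℂ] complexBetti S (2 * 1))
    (ht : IsCycleInducedTranscendentalEndomorphism S hS.isSmoothProjective t)
    (ht_ev : ∃ (σ₁ : complexBetti S (2 * 1)) (ev : ℂ), IsOfHodgeType 2 S (2 * 1) 2 0 σ₁ ∧ σ₁ ≠ 0 ∧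
      t σ₁ = ev • σ₁ ∧ (minpoly ℚ ev).natDegree = d) :
    HodgeConjectureFor 4 (S ⊗ S) := by
  obtain ⟨hrat, htyp, hN, hperp, hcyc⟩ := ht
  exact hodgeConjectureFor_square_of_generatedBy_of_mapsTo complexOrientationFamily hS.isSmoothProjective t
    (mapsTo_algebraicClasses_one hS.isSmoothProjective t hrat htyp) hcyc
    (transcendentalEndomorphismsGeneratedBy_of_generatedBy_of_natDegree hmark hS θ hθ_rat hθ_typ hθ_gen hθ_ev t
      hrat htyp hN hperp ht_ev)

/-- **ONE CYCLE SUFFICES IN A KNOWN RM TYPE OF PRIME DEGREE (any irrational eigenvalue).** As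
`hodgeConjectureFor_square_of_generatedBy_of_cycleInduced_natDegree` with `d` prime and the `(2,0)`-eigenvalue of
`t` merely IRRATIONAL. Modulo markings only. [cite: GeemenSchutt2023, §4.8 and Rem. 4.9] [cite: Varesco2023, §2 (p. 8)] -/
theorem hodgeConjectureFor_square_of_generatedBy_of_cycleInduced_irrational_of_prime
    (hmark : Huybrechts_K3_marking_exists) (hS : IsK3Surface S)
    (θ : complexBetti S (2 * 1) →ₗ[ℂ] complexBetti S (2 * 1))
    (hθ_rat : ∀ y, IsRationalClass y → IsRationalClass (θ y))
    (hθ_typ : ∀ (i j : ℕ) y, IsOfHodgeType 2 S (2 * 1) i j y → IsOfHodgeType 2 S (2 * 1) i j (θ y))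
    (hθ_gen : TranscendentalEndomorphismsGeneratedBy S θ) {d : ℕ} (hp : d.Prime)
    (hθ_ev : ∃ (σ₀ : complexBetti S (2 * 1)) (ev₀ : ℂ), IsOfHodgeType 2 S (2 * 1) 2 0 σ₀ ∧ σ₀ ≠ 0 ∧
      θ σ₀ = ev₀ • σ₀ ∧ (minpoly ℚ ev₀).natDegree = d)
    (t : complexBetti S (2 * 1) →ₗ[ℂ] complexBetti S (2 * 1))
    (ht : IsCycleInducedTranscendentalEndomorphism S hS.isSmoothProjective t)
    (ht_ev : ∃ (σ₁ : complexBetti S (2 * 1)) (ev : ℂ), IsOfHodgeType 2 S (2 * 1) 2 0 σ₁ ∧ σ₁ ≠ 0 ∧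
      t σ₁ = ev • σ₁ ∧ ∀ a : ℚ, (a : ℂ) ≠ ev) :
    HodgeConjectureFor 4 (S ⊗ S) := by
  obtain ⟨hrat, htyp, hN, hperp, hcyc⟩ := ht
  exact hodgeConjectureFor_square_of_generatedBy_of_mapsTo complexOrientationFamily hS.isSmoothProjective t
    (mapsTo_algebraicClasses_one hS.isSmoothProjective t hrat htyp) hcyc
    (transcendentalEndomorphismsGeneratedBy_of_generatedBy_of_irrational_of_prime hmark hS θ hθ_rat hθ_typ hθ_gen
      hp hθ_ev t hrat htyp hN hperp ht_ev)

/-! ### §2 van Geemen–Schütt's vocabulary: `IsRealMultiplicationK3 S ρ P`, `P` irreducible -/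

/-- **An RM K3 surface of type `ℚ[X]/(P)` (`P` irreducible) carries a generating `θ` whose `(2,0)`-eigenvalue has
degree `deg P`** (granted markings): the generator `t₀` of `IsRealMultiplicationK3` is annihilated by `P` on `T(S)`,
so its eigenvalue is a root of the irreducible `P` (`minpoly.eq_of_irreducible`).
[cite: GeemenSchutt2023, §2.1] [cite: Zarhin1983HodgeGroupsK3, Thm. 1.5.1] -/
theorem exists_generator_natDegree_of_isRealMultiplicationK3 (hmark : Huybrechts_K3_marking_exists) {ρ : ℕ}
    {P : ℚ[X]} (h : IsRealMultiplicationK3 S ρ P) (hP : Irreducible P) :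
    ∃ θ : complexBetti S (2 * 1) →ₗ[ℂ] complexBetti S (2 * 1),
      (∀ y, IsRationalClass y → IsRationalClass (θ y)) ∧
      (∀ (i j : ℕ) y, IsOfHodgeType 2 S (2 * 1) i j y → IsOfHodgeType 2 S (2 * 1) i j (θ y)) ∧
      TranscendentalEndomorphismsGeneratedBy S θ ∧
      ∃ (σ₀ : complexBetti S (2 * 1)) (ev₀ : ℂ), IsOfHodgeType 2 S (2 * 1) 2 0 σ₀ ∧ σ₀ ≠ 0 ∧
        θ σ₀ = ev₀ • σ₀ ∧ (minpoly ℚ ev₀).natDegree = P.natDegree := by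
  obtain ⟨hS, -, -, θ, h1, h2, -, -, hPθ, hgen⟩ := h
  obtain ⟨σ, hσ20, hσne, hσT, hline⟩ := exists_twoZero_transc hmark hS
  obtain ⟨ev₀, hev₀⟩ := hline (θ σ) (h2 2 0 σ hσ20)
  refine ⟨θ, h1, h2, hgen, σ, ev₀, hσ20, hσne, hev₀, ?_⟩
  have hroot : aeval ev₀ P = 0 := by
    have h := hPθ σ hσT
    rw [(aeval_ratPoly_apply_surface hS.isSmoothProjective θ h1 h2 hev₀ P).2.2] at h
    exact (smul_eq_zero.1 h).resolve_right hσne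
  rw [← minpoly.eq_of_irreducible hP hroot, Polynomial.natDegree_mul_C]
  exact inv_ne_zero fun h0 => hP.ne_zero (Polynomial.leadingCoeff_eq_zero.1 h0)

/-- **HC⁴(S × S) for an RM K3 surface of type `ℚ[X]/(P)` carrying ONE algebraic self-correspondence whose
`(2,0)`-eigenvalue has degree `deg P`** (granted markings; no Buskin, no degree law).
[cite: GeemenSchutt2023, §4.8 and Rem. 4.9] [cite: Varesco2023, §2 (p. 8)] [cite: Zarhin1983HodgeGroupsK3, Thm. 1.5.1] -/
theorem hodgeConjectureFor_square_of_isRealMultiplicationK3_of_cycleInduced_natDegree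
    (hmark : Huybrechts_K3_marking_exists) {ρ : ℕ} {P : ℚ[X]} (h : IsRealMultiplicationK3 S ρ P) (hP : Irreducible P)
    (t : complexBetti S (2 * 1) →ₗ[ℂ] complexBetti S (2 * 1))
    (ht : IsCycleInducedTranscendentalEndomorphism S h.isK3Surface.isSmoothProjective t)
    (ht_ev : ∃ (σ₁ : complexBetti S (2 * 1)) (ev : ℂ), IsOfHodgeType 2 S (2 * 1) 2 0 σ₁ ∧ σ₁ ≠ 0 ∧
      t σ₁ = ev • σ₁ ∧ (minpoly ℚ ev).natDegree = P.natDegree) :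
    HodgeConjectureFor 4 (S ⊗ S) := by
  obtain ⟨θ, h1, h2, hgen, hθ_ev⟩ := exists_generator_natDegree_of_isRealMultiplicationK3 hmark h hP
  exact hodgeConjectureFor_square_of_generatedBy_of_cycleInduced_natDegree hmark h.isK3Surface θ h1 h2 hgen hθ_ev t
    ht ht_ev

/-- **HC⁴(S × S) for an RM K3 surface of PRIME type degree carrying ONE algebraic self-correspondence with an
IRRATIONAL `(2,0)`-eigenvalue** (granted markings) — e.g. the K3 sides of the cells `(3,2)`, `(3,5)` (`ρ(S) = 2`,
`[E:ℚ] ∈ {2, 5}`) and `(2,3)`, `(2,7)` (`ρ(S) = 1`, `[E:ℚ] ∈ {3, 7}`) of crux #5.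
[cite: GeemenSchutt2023, §4.8, Rem. 4.9 and Thm. 1.1 (11)] [cite: Varesco2023, §2 (p. 8)] -/
theorem hodgeConjectureFor_square_of_isRealMultiplicationK3_of_cycleInduced_irrational_of_prime
    (hmark : Huybrechts_K3_marking_exists) {ρ : ℕ} {P : ℚ[X]} (h : IsRealMultiplicationK3 S ρ P) (hP : Irreducible P)
    (hp : P.natDegree.Prime) (t : complexBetti S (2 * 1) →ₗ[ℂ] complexBetti S (2 * 1))
    (ht : IsCycleInducedTranscendentalEndomorphism S h.isK3Surface.isSmoothProjective t)
    (ht_ev : ∃ (σ₁ : complexBetti S (2 * 1)) (ev : ℂ), IsOfHodgeType 2 S (2 * 1) 2 0 σ₁ ∧ σ₁ ≠ 0 ∧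
      t σ₁ = ev • σ₁ ∧ ∀ a : ℚ, (a : ℂ) ≠ ev) :
    HodgeConjectureFor 4 (S ⊗ S) := by
  obtain ⟨θ, h1, h2, hgen, hθ_ev⟩ := exists_generator_natDegree_of_isRealMultiplicationK3 hmark h hP
  exact hodgeConjectureFor_square_of_generatedBy_of_cycleInduced_irrational_of_prime hmark h.isK3Surface θ h1 h2
    hgen hp hθ_ev t ht ht_ev

/-- **An RM K3 surface of known type with one cycle of full eigenvalue degree is a CYCLE-INDUCED RM K3 surface**
(`IsCycleInducedRMK3`, for the minimal polynomial of the eigenvalue of the cycle): the cycle generates («K3-CELL-GEN»)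
and its minimal polynomial annihilates it on `T(S)` (`apply_eq_zero_of_transc_of_apply_twoZero_eq_zero`).
[cite: GeemenSchutt2023, §1, §2.1 and §4.8] [cite: Zarhin1983HodgeGroupsK3, Thm. 1.5.1] -/
theorem isCycleInducedRMK3_of_isRealMultiplicationK3_of_cycleInduced_natDegree
    (hmark : Huybrechts_K3_marking_exists) {ρ : ℕ} {P : ℚ[X]} (h : IsRealMultiplicationK3 S ρ P) (hP : Irreducible P)
    (t : complexBetti S (2 * 1) →ₗ[ℂ] complexBetti S (2 * 1))
    (ht : IsCycleInducedTranscendentalEndomorphism S h.isK3Surface.isSmoothProjective t) {ev : ℂ}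
    (ht_ev : ∃ σ₁ : complexBetti S (2 * 1), IsOfHodgeType 2 S (2 * 1) 2 0 σ₁ ∧ σ₁ ≠ 0 ∧
      t σ₁ = ev • σ₁ ∧ (minpoly ℚ ev).natDegree = P.natDegree) :
    IsCycleInducedRMK3 S ρ (minpoly ℚ ev) := by
  have hS : IsK3Surface S := h.isK3Surface
  obtain ⟨θ, h1, h2, hgen, hθ_ev⟩ := exists_generator_natDegree_of_isRealMultiplicationK3 hmark h hP
  obtain ⟨σ₁, h20₁, hne₁, htσ₁, hdeg⟩ := ht_ev
  have hrat := ht.1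
  have htyp := ht.2.1
  refine ⟨hS, h.finrank_algebraicClasses_one, h.not_hasComplexMultiplication, t, ht, ?_,
    transcendentalEndomorphismsGeneratedBy_of_generatedBy_of_natDegree hmark hS θ h1 h2 hgen hθ_ev t hrat htyp
      ht.2.2.1 ht.2.2.2.1 ⟨σ₁, ev, h20₁, hne₁, htσ₁, hdeg⟩⟩
  -- `minpoly(ev)(t)` is rational, type-preserving and kills `σ₁`, hence vanishes on `T(S)`
  intro y hy
  obtain ⟨hq1, hq2, hq3⟩ := aeval_ratPoly_apply_surface hS.isSmoothProjective t hrat htyp htσ₁ (minpoly ℚ ev)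
  exact apply_eq_zero_of_transc_of_apply_twoZero_eq_zero hmark hS _ hq1 hq2
    ⟨σ₁, h20₁, hne₁, by rw [hq3, minpoly.aeval, zero_smul]⟩ y hy

/-! ### §3 The Hilbert square -/

/-- **HC⁴(S^{[2]}) for an RM K3 surface of prime type degree with ONE cycle of irrational eigenvalue** (granted
markings and Beauville's blow-up description of `S^{[2]}`): `hodgeConjectureFor_square_of_isRealMultiplicationK3_of_cycleInduced_irrational_of_prime`
and `PartnerLattice.hodgeConjectureFor_hilbertSquare_of_square`. For `ρ(S) = 2`, `P = minpoly(ζ₁₁ + ζ₁₁⁻¹)` this is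
the K3-side input of cell `(3,5)` of crux `LowPicardRealMultiplication` at Hilbert squares (`ρ(S^{[2]}) = 3`).
[cite: GeemenSchutt2023, Thm. 1.1 (11) and §4.8] [cite: Beauville1983, §6] -/
theorem hodgeConjectureFor_hilbertSquare_of_isRealMultiplicationK3_of_cycleInduced_irrational_of_prime
    (hmark : Huybrechts_K3_marking_exists) (hBl : Beauville1983_hilbertSquare_blowupDiagonal_surjection)
    {ρ : ℕ} {P : ℚ[X]} (h : IsRealMultiplicationK3 S ρ P) (hP : Irreducible P) (hp : P.natDegree.Prime)
    {Ξ : (S ⊗ H).left.IdealSheafData} (hHilb : IsHilbertSchemeOfPoints 2 S H Ξ) (hH : IsSmoothProjective 4 H)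
    (t : complexBetti S (2 * 1) →ₗ[ℂ] complexBetti S (2 * 1))
    (ht : IsCycleInducedTranscendentalEndomorphism S h.isK3Surface.isSmoothProjective t)
    (ht_ev : ∃ (σ₁ : complexBetti S (2 * 1)) (ev : ℂ), IsOfHodgeType 2 S (2 * 1) 2 0 σ₁ ∧ σ₁ ≠ 0 ∧
      t σ₁ = ev • σ₁ ∧ ∀ a : ℚ, (a : ℂ) ≠ ev) :
    HodgeConjectureFor 4 H :=
  PartnerLattice.hodgeConjectureFor_hilbertSquare_of_square hBl h.isK3Surface.isSmoothProjective hHilb hH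
    (hodgeConjectureFor_square_of_isRealMultiplicationK3_of_cycleInduced_irrational_of_prime hmark h hP hp t ht ht_ev)

/-- **HC⁴(S^{[2]}) for an RM K3 surface of known type with ONE cycle of full eigenvalue degree** (degree form;
granted markings and Beauville's blow-up description). [cite: GeemenSchutt2023, §4.8] [cite: Beauville1983, §6] -/
theorem hodgeConjectureFor_hilbertSquare_of_isRealMultiplicationK3_of_cycleInduced_natDegree
    (hmark : Huybrechts_K3_marking_exists) (hBl : Beauville1983_hilbertSquare_blowupDiagonal_surjection)
    {ρ : ℕ} {P : ℚ[X]} (h : IsRealMultiplicationK3 S ρ P) (hP : Irreducible P)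
    {Ξ : (S ⊗ H).left.IdealSheafData} (hHilb : IsHilbertSchemeOfPoints 2 S H Ξ) (hH : IsSmoothProjective 4 H)
    (t : complexBetti S (2 * 1) →ₗ[ℂ] complexBetti S (2 * 1))
    (ht : IsCycleInducedTranscendentalEndomorphism S h.isK3Surface.isSmoothProjective t)
    (ht_ev : ∃ (σ₁ : complexBetti S (2 * 1)) (ev : ℂ), IsOfHodgeType 2 S (2 * 1) 2 0 σ₁ ∧ σ₁ ≠ 0 ∧
      t σ₁ = ev • σ₁ ∧ (minpoly ℚ ev).natDegree = P.natDegree) :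
    HodgeConjectureFor 4 H :=
  PartnerLattice.hodgeConjectureFor_hilbertSquare_of_square hBl h.isK3Surface.isSmoothProjective hHilb hH
    (hodgeConjectureFor_square_of_isRealMultiplicationK3_of_cycleInduced_natDegree hmark h hP t ht ht_ev)

end Summit.HodgeConjecture.HodgeConjecture.Theorems.MarkmanPartnerTransport.OneCycle

end
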